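import Summits.RiemannHypothesis.RiemannHypothesis.Theorems.PfPersistenceFfWeilCriterionSharpAllQSmall

/-!
# Function-field mirror: sharpness of the positivity depth at EVERY `q ≥ 2` — genus `4` (sums)
(pub-rhpf, seat ffmirror-2 gen 8; HONEST FRAMING: mechanism/rigidity campaign — no RH claims)


Part 1 (sums): the `g = 4` member `h_4(q) = x⁸ - q x⁶ - x⁵ + 2x⁴ - q x³ - q³x² + q⁴` of the integer
family `x^{2g-D} B_D(x) + q^{g-D} x^D B_D(q/x)`, `D = 2⌊g/2⌋`, `B_D = x^{D-2}(x² - q) - x + 1` (see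
`PfPersistenceFfWeilCriterionSharpAllQSmall` for `g ≤ 3`): coefficients, the coefficient functional
equation, monicity and degree, the off-circle real root in `(√q, q]` from `h_4(√q) = 2q^2(1 - √q) <
0 ≤ h_4(q)` (so the function-field RH FAILS for the datum), the window power sums `s_0, …, s_6` by
Newton's identities symbolically in `q`, and the real lattice window `S_6(q, h_4(q))`
(`MotivicDoorFfRealLattice.realLattice`) written out as a matrix of integer polynomials in `q`.
Nothing here is a statement about `ζ`; 'RH' always means the function-field statement
`∀ α ∈ frobRoots h, ‖α‖ = √q` for the one datum at hand.  All [folklore]: explicit algebra (Newton's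
identities, Sylvester/`LDLᵀ`), new only as kernel-checked statements binding BY NAME to `weilWindowForm`.
-/

set_option linter.dupNamespace false  -- the mandated namespace repeats `RiemannHypothesis`

noncomputable section

open Polynomial Matrix Finset
open scoped ComplexOrder ComplexConjugate
open Summit.RiemannHypothesis.RiemannHypothesis.Theorems.MotivicDoor.FfRealLattice
  (realLattice realLattice_nonneg_iff_posSemidef)

namespace Summit.RiemannHypothesis.RiemannHypothesis.Theorems.PfPersistence.FfAngleTwin

/-- The `g = 4` member `h_4(q)` of the all-`q` family (`D = 4`). [folklore] -/
def hAQ4 (q : ℕ) : ℤ[X] :=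
  X ^ 8 - C (q : ℤ) * X ^ 6 - X ^ 5 + C 2 * X ^ 4 - C (q : ℤ) * X ^ 3 - C ((q : ℤ) ^ 3) * X ^ 2
    + C ((q : ℤ) ^ 4)

/-- Coefficients of `h_4(q)`. [folklore] -/
theorem coeff_hAQ4 (q j : ℕ) : (hAQ4 q).coeff j =
    (if j = 8 then 1 else 0) - (if j = 6 then (q : ℤ) else 0) - (if j = 5 then 1 else 0)
      + (if j = 4 then 2 else 0) - (if j = 3 then (q : ℤ) else 0)
      - (if j = 2 then ((q : ℤ) ^ 3) else 0) + (if j = 0 then ((q : ℤ) ^ 4) else 0) := by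
  simp only [hAQ4, coeff_add, coeff_sub, coeff_X_pow, coeff_C_mul, coeff_C, mul_ite, mul_one,
    mul_zero]

/-- `h_4(q)` is monic. [folklore] -/
theorem hAQ4_monic (q : ℕ) : (hAQ4 q).Monic := by
  unfold hAQ4; monicity <;> norm_num

/-- `deg h_4(q) = 8`. [folklore] -/
theorem natDegree_hAQ4 (q : ℕ) : (hAQ4 q).natDegree = 2 * 4 := by
  unfold hAQ4; compute_degree <;> norm_num

/-- Coefficient functional equation of `h_4(q)`: `q^4 c_j = q^i c_i` for `i + j = 8`.
[folklore] -/
theorem hAQ4_fe (q : ℕ) :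
    ∀ i j, i + j = 2 * 4 → (q : ℤ) ^ 4 * (hAQ4 q).coeff j = (q : ℤ) ^ i * (hAQ4 q).coeff i := by
  intro i j hij
  have hi : i ≤ 8 := by omega
  interval_cases i
  · obtain rfl : j = 8 := by omega
    simp [coeff_hAQ4]
  · obtain rfl : j = 7 := by omega
    simp [coeff_hAQ4]
  · obtain rfl : j = 6 := by omega
    simp [coeff_hAQ4]; ring
  · obtain rfl : j = 5 := by omega
    simp [coeff_hAQ4]; ring
  · obtain rfl : j = 4 := by omega
    simp [coeff_hAQ4]
  · obtain rfl : j = 3 := by omega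
    simp [coeff_hAQ4]; ring
  · obtain rfl : j = 2 := by omega
    simp [coeff_hAQ4]; ring
  · obtain rfl : j = 1 := by omega
    simp [coeff_hAQ4]
  · obtain rfl : j = 0 := by omega
    simp [coeff_hAQ4]; ring

/-- `h_4(q)(√q) = 2q^2(1 - √q) < 0 ≤ h_4(q)(q)` for `q ≥ 2`: a real root in `(√q, q]`, so the
function-field RH FAILS for `(q, h_4(q))`. [folklore] -/
theorem exists_offCircle_hAQ4 (q : ℕ) (hq : 2 ≤ q) :
    ∃ α ∈ frobRoots (hAQ4 q), ‖α‖ ≠ Real.sqrt q := by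
  have hqr : (2 : ℝ) ≤ q := by exact_mod_cast hq
  have hs : Real.sqrt q * Real.sqrt q = q := Real.mul_self_sqrt (by positivity)
  have hs1 : 1 < Real.sqrt q := by
    rw [show (1 : ℝ) = Real.sqrt 1 by simp]
    exact Real.sqrt_lt_sqrt (by norm_num) (by linarith)
  have hev : ∀ x : ℝ, ((hAQ4 q).map (Int.castRingHom ℝ)).eval x
      = x ^ 8 - (q : ℝ) * x ^ 6 - x ^ 5 + 2 * x ^ 4 - (q : ℝ) * x ^ 3 - ((q : ℝ) ^ 3) * x ^ 2
        + ((q : ℝ) ^ 4) := by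
    intro x
    simp only [hAQ4, eval_map, eval₂_add, eval₂_sub, eval₂_mul, eval₂_X_pow, eval₂_C]
    simp only [eq_intCast, Int.cast_pow, Int.cast_natCast,
      Int.cast_ofNat]
  refine exists_offCircle_of_eval_sqrt_neg (hAQ4_monic q) (b := q) ?_ ?_ ?_
  · have h1 : Real.sqrt q * 1 ≤ Real.sqrt q * Real.sqrt q :=
      mul_le_mul_of_nonneg_left hs1.le (Real.sqrt_nonneg _)
    rw [mul_one, hs] at h1
    exact h1
  · rw [hev]
    have h2 : Real.sqrt q ^ 2 = (q : ℝ) := Real.sq_sqrt (by positivity)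
    have h3 : Real.sqrt q ^ 3 = (q : ℝ) ^ 1 * Real.sqrt q := by
      rw [pow_succ, show (2 : ℕ) = 2 * 1 from rfl, pow_mul, h2]
    have h4 : Real.sqrt q ^ 4 = (q : ℝ) ^ 2 := by
      rw [show (4 : ℕ) = 2 * 2 from rfl, pow_mul, h2]
    have h5 : Real.sqrt q ^ 5 = (q : ℝ) ^ 2 * Real.sqrt q := by
      rw [pow_succ, show (4 : ℕ) = 2 * 2 from rfl, pow_mul, h2]
    have h6 : Real.sqrt q ^ 6 = (q : ℝ) ^ 3 := by
      rw [show (6 : ℕ) = 2 * 3 from rfl, pow_mul, h2]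
    have h8 : Real.sqrt q ^ 8 = (q : ℝ) ^ 4 := by
      rw [show (8 : ℕ) = 2 * 4 from rfl, pow_mul, h2]
    rw [h8, h6, h5, h4, h3, h2]
    have : (q : ℝ) ^ 4 - (q : ℝ) * (q : ℝ) ^ 3 - ((q : ℝ) ^ 2 * Real.sqrt q) + 2 * (q : ℝ) ^ 2
      - (q : ℝ) * ((q : ℝ) ^ 1 * Real.sqrt q) - ((q : ℝ) ^ 3) * (q : ℝ) + ((q : ℝ) ^ 4)
        = 2 * (q : ℝ) ^ 2 * (1 - Real.sqrt q) := by ring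
    rw [this]
    have hq2 : 0 < (q : ℝ) ^ 2 := by positivity
    nlinarith
  · rw [hev]
    have : (q : ℝ) ^ 8 - (q : ℝ) * (q : ℝ) ^ 6 - (q : ℝ) ^ 5 + 2 * (q : ℝ) ^ 4
      - (q : ℝ) * (q : ℝ) ^ 3 - ((q : ℝ) ^ 3) * (q : ℝ) ^ 2 + ((q : ℝ) ^ 4)
        = (q : ℝ) ^ 4 * (((q : ℝ) - 1) * ((q : ℝ) ^ 3 - 2)) := by ring
    rw [this]
    have hq8 : (2 : ℝ) ^ 3 ≤ (q : ℝ) ^ 3 :=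
      pow_le_pow_left₀ (by norm_num) hqr 3
    exact mul_nonneg (by positivity) (mul_nonneg (by linarith) (by nlinarith))

/-- Vieta for `h_4(q)`. [folklore] -/
theorem esymm_hAQ4 (q k : ℕ) (hk : k ≤ 8) :
    (frobRoots (hAQ4 q)).esymm k = (-1) ^ k * (((hAQ4 q).coeff (8 - k) : ℤ) : ℂ) := by
  have h := esymm_frobRoots (hAQ4_monic q) (k := k) (by rw [natDegree_hAQ4 q]; omega)
  rwa [natDegree_hAQ4 q] at h

/-- The window power sums `s_0, …, s_6` of the roots of `h_4(q)`, by 6 Newton steps from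
the coefficients (no root is computed). [folklore] -/
theorem powerSum_hAQ4 (q : ℕ) :
    powerSum (frobRoots (hAQ4 q)) 0 = 8 ∧
    powerSum (frobRoots (hAQ4 q)) 1 = 0 ∧
    powerSum (frobRoots (hAQ4 q)) 2 = 2 * (q : ℂ) ∧
    powerSum (frobRoots (hAQ4 q)) 3 = 3 ∧
    powerSum (frobRoots (hAQ4 q)) 4 = -8 + 2 * (q : ℂ) ^ 2 ∧
    powerSum (frobRoots (hAQ4 q)) 5 = 10 * (q : ℂ) ∧
    powerSum (frobRoots (hAQ4 q)) 6 = 3 - 12 * (q : ℂ) + 8 * (q : ℂ) ^ 3 := by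
  set A := frobRoots (hAQ4 q) with hA
  have s0 : powerSum A 0 = 8 := by
    rw [powerSum]
    simp only [pow_zero, Multiset.map_const', Multiset.sum_replicate, nsmul_eq_mul, mul_one]
    rw [hA, card_frobRoots_eq_natDegree, natDegree_hAQ4]; norm_num
  have e0 : A.esymm 0 = 1 := multiset_esymm_zero A
  have e1 : A.esymm 1 = 0 := by
    rw [esymm_hAQ4 q 1 (by norm_num), coeff_hAQ4]; norm_num
  have e2 : A.esymm 2 = -(q : ℂ) := by
    rw [esymm_hAQ4 q 2 (by norm_num), coeff_hAQ4]; norm_num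
  have e3 : A.esymm 3 = 1 := by
    rw [esymm_hAQ4 q 3 (by norm_num), coeff_hAQ4]; norm_num
  have e4 : A.esymm 4 = 2 := by
    rw [esymm_hAQ4 q 4 (by norm_num), coeff_hAQ4]; norm_num
  have e5 : A.esymm 5 = (q : ℂ) := by
    rw [esymm_hAQ4 q 5 (by norm_num), coeff_hAQ4]; norm_num
  have e6 : A.esymm 6 = -(q : ℂ) ^ 3 := by
    rw [esymm_hAQ4 q 6 (by norm_num), coeff_hAQ4]; norm_num
  have n1 := newton_range A 1
  have n2 := newton_range A 2
  have n3 := newton_range A 3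
  have n4 := newton_range A 4
  have n5 := newton_range A 5
  have n6 := newton_range A 6
  simp only [sum_range_succ, sum_range_zero, zero_add, e0, e1, e2, e3, e4, e5, e6] at n1 n2 n3 n4 n5 n6
  have s1 : powerSum A 1 = 0 := by linear_combination -n1
  have s2 : powerSum A 2 = 2 * (q : ℂ) := by linear_combination n2
  have s3 : powerSum A 3 = 3 := by linear_combination -n3 - (-(q : ℂ)) * s1
  have s4 : powerSum A 4 = -8 + 2 * (q : ℂ) ^ 2 := by linear_combination n4 - (-(q : ℂ)) * s2
    + 1 * s1
  have s5 : powerSum A 5 = 10 * (q : ℂ) := by linear_combination -n5 - (-(q : ℂ)) * s3 + 1 * s2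
    - 2 * s1
  have s6 : powerSum A 6 = 3 - 12 * (q : ℂ) + 8 * (q : ℂ) ^ 3 := by linear_combination n6
    - (-(q : ℂ)) * s4 + 1 * s3 - 2 * s2 + (q : ℂ) * s1
  exact ⟨s0, s1, s2, s3, s4, s5, s6⟩

/-- The real lattice window `S_6(q, h_4(q)) = (q^{min(m,m')} s_{|m-m'|})_{m,m' ≤ 6}`.
[folklore] -/
theorem realLattice_hAQ4 (q : ℕ) :
    realLattice q (hAQ4 q) 6 =
      !![8, 0, 2 * (q : ℝ), 3, -8 + 2 * (q : ℝ) ^ 2, 10 * (q : ℝ),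
           3 - 12 * (q : ℝ) + 8 * (q : ℝ) ^ 3;
         0, (q : ℝ) * 8, 0, (q : ℝ) * (2 * (q : ℝ)), (q : ℝ) * 3, (q : ℝ) * (-8 + 2 * (q : ℝ) ^ 2),
           (q : ℝ) * (10 * (q : ℝ));
         2 * (q : ℝ), 0, (q : ℝ) ^ 2 * 8, 0, (q : ℝ) ^ 2 * (2 * (q : ℝ)), (q : ℝ) ^ 2 * 3,
           (q : ℝ) ^ 2 * (-8 + 2 * (q : ℝ) ^ 2);
         3, (q : ℝ) * (2 * (q : ℝ)), 0, (q : ℝ) ^ 3 * 8, 0, (q : ℝ) ^ 3 * (2 * (q : ℝ)),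
           (q : ℝ) ^ 3 * 3;
         -8 + 2 * (q : ℝ) ^ 2, (q : ℝ) * 3, (q : ℝ) ^ 2 * (2 * (q : ℝ)), 0, (q : ℝ) ^ 4 * 8, 0,
           (q : ℝ) ^ 4 * (2 * (q : ℝ));
         10 * (q : ℝ), (q : ℝ) * (-8 + 2 * (q : ℝ) ^ 2), (q : ℝ) ^ 2 * 3,
           (q : ℝ) ^ 3 * (2 * (q : ℝ)), 0, (q : ℝ) ^ 5 * 8, 0;
         3 - 12 * (q : ℝ) + 8 * (q : ℝ) ^ 3, (q : ℝ) * (10 * (q : ℝ)),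
           (q : ℝ) ^ 2 * (-8 + 2 * (q : ℝ) ^ 2), (q : ℝ) ^ 3 * 3, (q : ℝ) ^ 4 * (2 * (q : ℝ)), 0,
           (q : ℝ) ^ 6 * 8] := by
  obtain ⟨s0, s1, s2, s3, s4, s5, s6⟩ := powerSum_hAQ4 q
  have r0 : (powerSum (frobRoots (hAQ4 q)) 0).re = 8 := by
    rw [s0]; simp
  have r1 : (powerSum (frobRoots (hAQ4 q)) 1).re = 0 := by
    rw [s1]; simp
  have r2 : (powerSum (frobRoots (hAQ4 q)) 2).re = 2 * (q : ℝ) := by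
    rw [s2]; simp
  have r3 : (powerSum (frobRoots (hAQ4 q)) 3).re = 3 := by
    rw [s3]; simp
  have r4 : (powerSum (frobRoots (hAQ4 q)) 4).re = -8 + 2 * (q : ℝ) ^ 2 := by
    rw [s4]; simp [pow_succ]
  have r5 : (powerSum (frobRoots (hAQ4 q)) 5).re = 10 * (q : ℝ) := by
    rw [s5]; simp
  have r6 : (powerSum (frobRoots (hAQ4 q)) 6).re = 3 - 12 * (q : ℝ) + 8 * (q : ℝ) ^ 3 := by
    rw [s6]; simp [pow_succ]
  ext m m'
  fin_cases m <;> fin_cases m' <;> simp [realLattice, Nat.dist, r0, r1, r2, r3, r4, r5, r6]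

end Summit.RiemannHypothesis.RiemannHypothesis.Theorems.PfPersistence.FfAngleTwin

end
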